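import Mathlib
import Literature.MathematicalPhysics.QuantumFieldTheory.Balaban1983to89.B15Eq112Admissible
import Literature.MathematicalPhysics.QuantumFieldTheory.Balaban1983to89.B15DeterminingSets

/-!
# `Balaban1983to89.B15Eq112TorusCover` — [Balaban1989LargeFieldI] (1.10)–(1.12) p. 179 ON THE TORUS `T_η` OF RECORD:
# the universal cover `ℤᵈ → T_η = Setup.Site P 0` identifies r12's torus display `B15DeterminingSets.omegaPP` (decl of
# record of row B15.Eq1.12) with p29 g14's cube-carrier construction `B15Eq112Admissible.omegaPP` — DEFINITIONS-register
# homonym H13 («`omegaPP` ×2») is ONE object by theorem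

statement-level skeleton of published theorems with citation tags; proofs where landed; nothing here is a claim about
the Yang–Mills mass gap.

CITATION HEADER (lean-in-tree rule 2026-08-18).  T. Bałaban, *Large field renormalization. I. The basic step of the 𝐑
operation*, Commun. Math. Phys. **122**, 175–202 (1989), doi:10.1007/BF01257412, bib `Balaban1989LargeFieldI` (cell paper
B15 = [IV]; PDF held `paper:balaban1989-cmp122-large-field-i`, journal page = PDF page + 174; p. 179 = PDF 5, read AS AN
IMAGE on the x2 render `b2b-balaban-ref1/pages/1989-cmp122-large-field-I/…-p005-x2.png`).  The torus: T. Bałaban,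
*Renormalization group approach to lattice gauge field theories. I*, Commun. Math. Phys. **109**, 249–301 (1987), bib
`Balaban1987RG1` ([I]; (0.1) p. 251 = PDF 3), and *Propagators and renormalization transformations for lattice gauge
theories. I*, Commun. Math. Phys. **95**, 17–40 (1984), bib `Balaban1984PropagatorsI` ([B5]; Sect. A p. 17).
WHAT IS REPRODUCED: SKELETON rows `B15.Eq1.12` / `B15.Eq1.10` / `B15.Eq1.11` (owner r12) — no new printed statement; this
file is the BRIDGE asked for by the DEFINITIONS register of the cell (`lit-balaban-r20/DEFINITIONS.md` v1.25, homonym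
**H13**: *"`B15Eq112Admissible.omegaPP` … on `Pt d` (ℤᵈ) vs r12-lineage `B15DeterminingSets.omegaPP : ℕ → Set (Site P 0)`
… on the torus carrier — the SAME printed object Ω″_j ((1.10)–(1.11)) on two carriers; relation status: NOT bridged"*).
Unit `lit-balaban-p29` gen 17 (Phase-2 free target, G.5-34(d)), HOME `run/shared/lean/pub/lit-balaban/`.
KNITTING — used BY NAME, nothing restated: r12 `B15DeterminingSets.{omegaPP, omegaPP_of_le, omegaPP_of_lt,
omegaPP_antitone, detSetN_top}`; p29 g14 `B15Eq112Admissible.{omegaPP, Zpp, completion, Hypotheses,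
Hypotheses.admissible_omegaPP_completion, omegaPP_completion_add_pmul, Hypotheses.Ω_subset_omegaPP, .zpp_subset_Z,
.zpp_disjoint_Ω, .zpp_mono, .Z_diff_zpp_subset, .isPeriodic_omegaPP, .lemma21_full_torGeo_omegaPP, isCompletion_completion}`;
b02 `B16Stage3Regions.OmegaPP`; p29 g13 `B15LatticeCubeTorus.pmul`; `Setup.{Params, Site, Params.sitesPerDir}`.

THE PRINTED TEXT ([IV] p. 179 [PDF 5], verbatim).  *"Define Z″_k = (Z′_{k−N₀})^{~3} = (Ω^{~5}_{k−N₀+1})ᶜ ∩ Z,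
Z″_{k−N₀+1} = (Z′_{k−N₀})^~ = (Ω^{~7}_{k−N₀+1})ᶜ ∩ Z, (1.10) and complete these two sets to a sequence Z″_k, Z″_{k−1}, …,
Z″_{k−N₀+2}, Z″_{k−N₀+1} in such a way that the complements of these sets form an admissible sequence of domains based on
partitions into M-cubes in the corresponding scales. … Next, define Z″_j = (Ω_j^{~5})ᶜ ∩ Z for j = k − N₀, k − N₀ − 1, …,
k − N + 1 = h + 1, Z″_j = Z_j for j = h, h − 1, …, 1. (1.11) This is the new sequence of the large field regions. We define
new domains Ω″_j by Ω″_j = (Z″ᶜ_j ∩ Z) ∪ (Ω_j ∩ Zᶜ) for j = k, k − 1, …, h + 1, Ω″_j = Ω_j for j = h, h − 1, …, 1. (1.12)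
The sequence {Ω″_j} is an admissible sequence"*.  The carrier: [I] p. 251 [PDF 3], verbatim: *"a torus T obtained by the
usual identification of boundary points of the cube {x ∈ R^d : −L_μ ≦ x_μ ≦ L_μ, μ = 1, …, d}"*, with its lattices
`T^{(j)}` — typed by the cell as `Setup.Site P j = Fin P.d → ZMod (P.sitesPerDir j)`, `P.sitesPerDir j = 2L^{m+K−j}`
(DIVERGENCE F2 of `Setup`: `L_μ = Lᵐ` for every `μ`); [B5] Sect. A p. 17: the same torus as `T_η`.

THE TWO TYPINGS OF Ω″_j AND WHY A BRIDGE IS A THEOREM, NOT A CONVENTION.  r12's `B15DeterminingSets.omegaPP Ω Z″ Z h j`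
(`Site P 0`) is the display (1.12) with the large-field sequence `Z″` as DATA; p29 g14's `B15Eq112Admissible.omegaPP L M h k₀
R Ω E Z j` (`Pt d = ℤᵈ`) is (1.12) with `Z″_j` CONSTRUCTED from `Ω`, `Z` by (1.10)–(1.11) (b02's `farZ` in the middle
regime, the §4 completion `E` of (1.10) on top) — the file in which *"{Ω″_j} is an admissible sequence"* is PROVED.  The two
agree through the universal cover `π : ℤᵈ → T_η`, `x ↦ x mod 2L^{m+K}` (`cover`): pulling r12's torus sets back along `π`
gives deck-invariant cover sets, (1.12) commutes with pull-back (§2), and — the one non-formal point — the constructed cover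
sequence `Z″` of torus data is itself deck-invariant (p29 g14 §9 `omegaPP_completion_add_pmul`, here through the trace
`Z″_j ∩ Z`, §3), so it DESCENDS to a torus sequence `ZppT` ("the large-field regions of record on `T_η`") whose pull-back it
is; with that `Z″`, r12's Ω″_j pulls back to p29's Ω″_j for EVERY `j` (§4 `preimage_omegaPP_record`).

WHAT THIS FILE PROVES (kernel-checked, zero `sorry`, axioms standard; definitions WITH BODIES `cover`, `per`, `lift`,
`pullSeq`, `ZppC`, `omegaPPC`, `ZppT`; no structure, no named fact).
§1 The universal cover `cover P : Pt P.d → Site P 0` and its deck group: `cover_add_pmul` (invariance under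
   `x ↦ x + (2L^{m+K})·v`), `cover_eq_cover_iff` (fibres = deck orbits), `cover_lift`/`cover_surjective`, `val_cover`
   (coordinates of `π x` = residues), `preimage_deck` (pull-backs are deck-invariant), `preimage_image_of_deck` (a
   deck-invariant cover set is the pull-back of its image), `image_preimage`.
§2 (1.12) commutes with pull-back along ANY map into the torus, and r12's display IS b02's `OmegaPP` display
   (`preimage_omegaPP_of_le`, `preimage_omegaPP_of_lt`); `OmegaPP` only sees the trace `Z″ ∩ Z` (`omegaPP_inter_right`).
§3 Torus data `Ω_j, Z ⊂ T_η` ↦ cover data (`pullSeq`, pull-backs), THE constructed cover sequences `ZppC` = g14 `Zpp` with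
   the g14 completion, `omegaPPC` = g14 `omegaPP` (THE (1.12) sequence), and the torus large-field regions of record
   `ZppT j := cover '' (ZppC j ∩ cover⁻¹ Z)`; **`preimage_ZppT`**: for `j > h` its pull-back is `ZppC j ∩ cover⁻¹ Z` (deck
   invariance of the trace, `zppC_inter_deck`, from `omegaPP_completion_add_pmul`); under g14's `Hypotheses` the trace is
   `ZppC j` itself for `j ≤ k` (`zppT_eq_image`).
§4 **THE BRIDGE `preimage_omegaPP_record`**: `cover ⁻¹' (B15DeterminingSets.omegaPP Ω_T ZppT Z_T h j) = omegaPPC j` for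
   every `j` (hypotheses: the cube sides in use divide the torus period — print's standing arrangement —, `1 ≤ L, M, R_j`);
   and its consequences BY NAME under g14's located `Hypotheses` on the cover data: `admissible_record` (r12's decl of
   record, instantiated with THE constructed `Z″`, is a [III]-(2.13)-admissible sequence read on the cover — the printed
   CLAIM of (1.12) for the decl of record), `Ω_subset_omegaPP_record`, `zppT_subset`, `zppT_disjoint` / `zppT_mono` /
   `Z_diff_zppT_subset` (= r12's Part-G / (1.17) hypotheses `hZ`, `hjoin`, `hdisj` DISCHARGED for this torus data),
   hence r12's `omegaPP_antitone` and (1.17) `detSetN_top` for the data of record with only print's inputs left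
   (`antitone_record`, `eq117_record`); `isPeriodic_record` (p29 g12/g13's torus periodicity datum for it; [B6] Lemma 2.1
   on `T_η` for it is g14's `Hypotheses.lemma21_full_torGeo_omegaPP` with `P := per`, by name).
§5 Non-vacuity with a GENUINE `Setup.Params` (`d = 1`, `L = 3`, `m = 1`, `K = 3`: 162 sites): torus data `Ω_T`, `Z_T ≠ ∅`
   on `Site P 0` whose pull-backs satisfy g14's `Hypotheses 3 1 0 1 3 R` together with every divisibility used above, and
   the bridge applied to them (`record_instance`).
HONEST SCOPE.  Set-level plumbing only; nothing analytic, no printed inequality.  The torus is `Setup`'s cube torus (all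
periods `2L^{m+K}`; p29 g12–g14's torus files allow a general period vector `P_μ`, specialised here to `per P`).  The
members `Z″_j`, `j ≤ h`, of (1.11) (`= Z_j`, the OLD large-field regions) are not modelled by g14's `Zpp` and r12's (1.12)
does not read them; accordingly `ZppT j` for `j ≤ h` is NOT print's `Z_j` (and is not used).  `ZppT` is defined through the
trace `Z″_j ∩ Z` so that the bridge needs no hypothesis; print's `Z″_j ⊂ Z` (g14 `zpp_subset_Z`) makes the trace
superfluous under `Hypotheses` (`zppT_eq_image`).  NOT summit progress.
-/

namespace Literature.MathematicalPhysics.QuantumFieldTheory.Balaban1983to89.B15Eq112TorusCover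

open Literature.MathematicalPhysics.QuantumFieldTheory.Balaban1983to89
open B14DomainGeom B14.Eq213MaximalDomains B16Stage3Regions B15LatticeCubeTorus B15Eq112Admissible

/-! ## §1. The universal cover `ℤᵈ → T_η` of the `Setup` torus and its deck translations -/

section Cover

variable (P : Params)

/-- **The universal cover** `π : ℤᵈ → T_η = T^{(0)}`, `x ↦ (x_μ mod 2L^{m+K})_μ` ([I] p. 251: *"a torus T obtained by the
usual identification of boundary points of the cube"*; the cell's `Site P 0 = Fin d → ZMod (2L^{m+K})`).  (Definitionally
the map `TreeLengthTorus.proj (P.sitesPerDir 0)` of the cell's tree-length torus model; restated here on `Site P 0` to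
keep the imports of this bridge minimal.) [cite: Balaban1987RG1, (0.1) p.251; Balaban1984PropagatorsI, Sect. A p.17] -/
def cover (x : Pt P.d) : Site P 0 := fun μ => ((x μ : ℤ) : ZMod (P.sitesPerDir 0))

/-- The period vector of the deck group of `cover`: `2L^{m+K}` in every direction (the cell's cube torus; print's
`2L_μ/ε`). [cite: Balaban1987RG1, (0.1) p.251] -/
def per : Fin P.d → ℕ := fun _ => P.sitesPerDir 0

/-- A section of the cover: the representative with coordinates in `[0, 2L^{m+K})` (print's fundamental cube up to the
choice of representatives). [cite: Balaban1987RG1, (0.1) p.251] -/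
def lift (a : Site P 0) : Pt P.d := fun μ => ((a μ).val : ℤ)

variable {P}

/-- Coordinates of `cover`. [cite: Balaban1987RG1, (0.1) p.251] -/
@[simp] theorem cover_apply (x : Pt P.d) (μ : Fin P.d) : cover P x μ = ((x μ : ℤ) : ZMod (P.sitesPerDir 0)) := rfl

/-- Coordinates of `per`. [cite: Balaban1987RG1, (0.1) p.251] -/
@[simp] theorem per_apply (μ : Fin P.d) : per P μ = P.sitesPerDir 0 := rfl

/-- The periods are positive. [cite: Balaban1987RG1, (0.1) p.251] -/
theorem per_pos (μ : Fin P.d) : 0 < per P μ := Nat.pos_of_ne_zero (P.sitesPerDir_ne_zero 0)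

/-- The residue coordinates of `π x` are the coordinates of `x` modulo the period. [cite: Balaban1987RG1, (0.1) p.251] -/
theorem val_cover (x : Pt P.d) (μ : Fin P.d) : ((cover P x μ).val : ℤ) = x μ % (P.sitesPerDir 0 : ℕ) :=
  ZMod.val_intCast _

/-- **Deck invariance**: `π (x + P·v) = π x`. [cite: Balaban1987RG1, (0.1) p.251] -/
@[simp] theorem cover_add_pmul (x v : Pt P.d) : cover P (x + pmul (per P) v) = cover P x := by
  funext μ
  simp [cover, pmul, per, Int.cast_add, Int.cast_mul]

/-- **The fibres of the cover are the deck orbits**: `π x = π y ↔ y = x + P·v` for some `v ∈ ℤᵈ`.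
[cite: Balaban1987RG1, (0.1) p.251] -/
theorem cover_eq_cover_iff (x y : Pt P.d) : cover P x = cover P y ↔ ∃ v, y = x + pmul (per P) v := by
  constructor
  · intro h
    have hμ : ∀ μ, ((P.sitesPerDir 0 : ℕ) : ℤ) ∣ y μ - x μ := fun μ =>
      (ZMod.intCast_eq_intCast_iff_dvd_sub (x μ) (y μ) (P.sitesPerDir 0)).1 (congrFun h μ)
    choose v hv using hμ
    refine ⟨v, funext fun μ => ?_⟩
    simp only [Pi.add_apply, pmul, per]
    have := hv μ
    omega
  · rintro ⟨v, rfl⟩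
    exact (cover_add_pmul x v).symm

/-- `π (lift a) = a`. [cite: Balaban1987RG1, (0.1) p.251] -/
@[simp] theorem cover_lift (a : Site P 0) : cover P (lift P a) = a := by
  funext μ
  simp [cover, lift]

/-- The cover is onto. [cite: Balaban1987RG1, (0.1) p.251] -/
theorem cover_surjective : Function.Surjective (cover P) := fun a => ⟨lift P a, cover_lift a⟩

/-- **Pull-backs of torus sets are deck-invariant** (a subset of `T_η` seen on the cover). [cite: Balaban1987RG1, (0.1) p.251] -/
theorem preimage_deck (X : Set (Site P 0)) (x v : Pt P.d) : x + pmul (per P) v ∈ cover P ⁻¹' X ↔ x ∈ cover P ⁻¹' X := by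
  simp only [Set.mem_preimage, cover_add_pmul]

/-- **A deck-invariant cover set is the pull-back of its image** (the torus set it represents). [cite: Balaban1987RG1, (0.1) p.251] -/
theorem preimage_image_of_deck {Y : Set (Pt P.d)} (hY : ∀ x v, x + pmul (per P) v ∈ Y ↔ x ∈ Y) :
    cover P ⁻¹' (cover P '' Y) = Y := by
  refine Set.Subset.antisymm ?_ (Set.subset_preimage_image _ _)
  rintro x ⟨y, hy, hyx⟩
  obtain ⟨v, rfl⟩ := (cover_eq_cover_iff y x).1 hyx
  exact (hY y v).2 hy

/-- Every torus set is the image of its pull-back. [cite: Balaban1987RG1, (0.1) p.251] -/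
theorem image_preimage (X : Set (Site P 0)) : cover P '' (cover P ⁻¹' X) = X :=
  Set.image_preimage_eq X cover_surjective

end Cover

/-! ## §2. (1.12) commutes with pull-back; r12's display is b02's `OmegaPP` display -/

section Display

variable {P : Params} {n : ℕ} (f : Pt n → Site P 0) (Ω Zpp : ℕ → Set (Site P 0)) (Z : Set (Site P 0)) (h : ℕ)

/-- Below `h`: the pull-back of r12's `Ω″_j = Ω_j` is the pull-back of `Ω_j`. [cite: Balaban1989LargeFieldI, (1.12) p.179] -/
theorem preimage_omegaPP_of_le {j : ℕ} (hj : j ≤ h) :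
    f ⁻¹' B15DeterminingSets.omegaPP Ω Zpp Z h j = f ⁻¹' Ω j := by
  rw [B15DeterminingSets.omegaPP_of_le hj]

/-- Above `h`: the pull-back of r12's `Ω″_j = (Z″ᶜ_j ∩ Z) ∪ (Ω_j ∩ Zᶜ)` is b02's display `OmegaPP` of the pull-backs —
(1.12) commutes with pull-back along any map and the two typings of the display coincide.
[cite: Balaban1989LargeFieldI, (1.12) p.179] -/
theorem preimage_omegaPP_of_lt {j : ℕ} (hj : h < j) :
    f ⁻¹' B15DeterminingSets.omegaPP Ω Zpp Z h j = OmegaPP (f ⁻¹' Zpp j) (f ⁻¹' Ω j) (f ⁻¹' Z) := by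
  rw [B15DeterminingSets.omegaPP_of_lt hj]
  ext x
  simp [OmegaPP]

/-- The display (1.12) only sees the trace `Z″ ∩ Z` of the large-field region. [cite: Balaban1989LargeFieldI, (1.12) p.179] -/
theorem omegaPP_inter_right {d : ℕ} (X Ω' Z' : Set (Pt d)) : OmegaPP (X ∩ Z') Ω' Z' = OmegaPP X Ω' Z' := by
  ext x
  simp only [OmegaPP, Set.mem_union, Set.mem_inter_iff, Set.mem_compl_iff]
  tauto

end Display

/-! ## §3. Torus data, the constructed cover sequences, and the torus large-field regions of record -/

section Record

variable {P : Params}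

/-- The cover data of a sequence of torus domains `{Ω_j}`: their pull-backs. [cite: Balaban1989LargeFieldI, (1.12) p.179] -/
abbrev pullSeq (ΩT : ℕ → Set (Site P 0)) : ℕ → Set (Pt P.d) := fun j => cover P ⁻¹' ΩT j

variable (L M h k₀ k : ℕ) (R : ℕ → ℕ) (ΩT : ℕ → Set (Site P 0)) (ZT : Set (Site P 0))

/-- **THE constructed large-field sequence `Z″` on the cover** for torus data `Ω_j, Z`: p29 g14's `Zpp` ((1.11) above `h`:
`(Ω_j^{~5})ᶜ ∩ Z` in the middle regime, the complement of the §4 completion of (1.10) on top) of the pull-backs.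
[cite: Balaban1989LargeFieldI, (1.10)–(1.11) p.179] -/
def ZppC (j : ℕ) : Set (Pt P.d) :=
  Zpp L M k₀ R (pullSeq ΩT) (completion L M k₀ k (cover P ⁻¹' ΩT (k₀ + 1)) (cover P ⁻¹' ZT)) (cover P ⁻¹' ZT) j

/-- **THE (1.12) sequence `Ω″` on the cover** for torus data: p29 g14's `omegaPP` of the pull-backs with the constructed
completion (the sequence PROVED admissible by `Hypotheses.admissible_omegaPP_completion`).
[cite: Balaban1989LargeFieldI, (1.12) p.179] -/
def omegaPPC (j : ℕ) : Set (Pt P.d) :=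
  omegaPP L M h k₀ R (pullSeq ΩT) (completion L M k₀ k (cover P ⁻¹' ΩT (k₀ + 1)) (cover P ⁻¹' ZT)) (cover P ⁻¹' ZT) j

/-- **The torus large-field regions of record** `Z″_j ⊂ T_η` (`j > h`): the image in `T_η` of the trace `Z″_j ∩ Z` of the
constructed cover sequence — the DATA to feed r12's `B15DeterminingSets.omegaPP`. [cite: Balaban1989LargeFieldI, (1.10)–(1.11) p.179] -/
def ZppT (j : ℕ) : Set (Site P 0) := cover P '' (ZppC L M k₀ k R ΩT ZT j ∩ cover P ⁻¹' ZT)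

variable {L M h k₀ k R ΩT ZT}

/-- Unfolding of `omegaPPC` above `h`. [cite: Balaban1989LargeFieldI, (1.12) p.179] -/
theorem omegaPPC_of_lt {j : ℕ} (hj : h < j) :
    omegaPPC L M h k₀ k R ΩT ZT j = OmegaPP (ZppC L M k₀ k R ΩT ZT j) (cover P ⁻¹' ΩT j) (cover P ⁻¹' ZT) := by
  simp only [omegaPPC, omegaPP_of_lt hj, ZppC]

/-- Unfolding of `omegaPPC` at and below `h`. [cite: Balaban1989LargeFieldI, (1.12) p.179] -/
theorem omegaPPC_of_le {j : ℕ} (hj : j ≤ h) : omegaPPC L M h k₀ k R ΩT ZT j = cover P ⁻¹' ΩT j := by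
  simp only [omegaPPC, omegaPP_of_le hj]

/-- `Z″_j` of record lies in `Z`. [cite: Balaban1989LargeFieldI, (1.11) p.179] -/
theorem zppT_subset (j : ℕ) : ZppT L M k₀ k R ΩT ZT j ⊆ ZT := by
  rintro a ⟨x, ⟨-, hx⟩, rfl⟩
  exact hx

/-- **THE (1.12) SEQUENCE IS DECK-INVARIANT** for torus data (g14 §9.1 BY NAME, periods `per P`; hypotheses: the cube sides in
use divide the period). [cite: Balaban1989LargeFieldI, (1.10)–(1.12) p.179; Balaban1984PropagatorsII, (2.1)–(2.4) p.224] -/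
theorem omegaPPC_deck (hL : 1 ≤ L) (hM : 1 ≤ M) (hR : ∀ j, 1 ≤ R j) (hdk : side L M k ∣ P.sitesPerDir 0)
    (hdj : ∀ j, j ≤ k₀ → side L M j * R j ∣ P.sitesPerDir 0) (j : ℕ) (x v : Pt P.d) :
    x + pmul (per P) v ∈ omegaPPC L M h k₀ k R ΩT ZT j ↔ x ∈ omegaPPC L M h k₀ k R ΩT ZT j :=
  omegaPP_completion_add_pmul hL hM hR (fun _ => hdk) (fun j hj _ => hdj j hj) (fun j => preimage_deck (ΩT j))
    (preimage_deck ZT) j x v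

/-- Inside `Z`, above `h`: `x ∈ Z″_j ↔ x ∉ Ω″_j`. [cite: Balaban1989LargeFieldI, (1.12) p.179] -/
theorem mem_zppC_inter_iff {j : ℕ} (hj : h < j) (x : Pt P.d) :
    x ∈ ZppC L M k₀ k R ΩT ZT j ∩ cover P ⁻¹' ZT ↔ x ∈ cover P ⁻¹' ZT ∧ x ∉ omegaPPC L M h k₀ k R ΩT ZT j := by
  rw [omegaPPC_of_lt hj]
  simp only [Set.mem_inter_iff, OmegaPP, Set.mem_union, Set.mem_compl_iff, Set.mem_preimage]
  tauto

/-- **The trace `Z″_j ∩ Z` of the constructed cover sequence is deck-invariant** (`j > h`). [cite: Balaban1989LargeFieldI, (1.10)–(1.12) p.179] -/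
theorem zppC_inter_deck (hL : 1 ≤ L) (hM : 1 ≤ M) (hR : ∀ j, 1 ≤ R j) (hdk : side L M k ∣ P.sitesPerDir 0)
    (hdj : ∀ j, j ≤ k₀ → side L M j * R j ∣ P.sitesPerDir 0) {j : ℕ} (hj : h < j) (x v : Pt P.d) :
    x + pmul (per P) v ∈ ZppC L M k₀ k R ΩT ZT j ∩ cover P ⁻¹' ZT ↔ x ∈ ZppC L M k₀ k R ΩT ZT j ∩ cover P ⁻¹' ZT := by
  rw [mem_zppC_inter_iff (h := h) hj, mem_zppC_inter_iff (h := h) hj, preimage_deck,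
    omegaPPC_deck hL hM hR hdk hdj]

/-- **The pull-back of the torus `Z″_j` of record is the trace of the constructed cover sequence** (`j > h`).
[cite: Balaban1989LargeFieldI, (1.10)–(1.11) p.179] -/
theorem preimage_ZppT (hL : 1 ≤ L) (hM : 1 ≤ M) (hR : ∀ j, 1 ≤ R j) (hdk : side L M k ∣ P.sitesPerDir 0)
    (hdj : ∀ j, j ≤ k₀ → side L M j * R j ∣ P.sitesPerDir 0) {j : ℕ} (hj : h < j) :
    cover P ⁻¹' ZppT L M k₀ k R ΩT ZT j = ZppC L M k₀ k R ΩT ZT j ∩ cover P ⁻¹' ZT :=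
  preimage_image_of_deck (zppC_inter_deck (h := h) hL hM hR hdk hdj hj)

end Record

/-! ## §4. THE BRIDGE and its consequences by name -/

section Bridge

variable {P : Params} {L M h k₀ k : ℕ} {R : ℕ → ℕ} {ΩT : ℕ → Set (Site P 0)} {ZT : Set (Site P 0)}

/-- **H13 BRIDGE.**  For torus data `Ω_j, Z ⊂ T_η` and the torus large-field regions of record `Z″ = ZppT`, r12's
`B15DeterminingSets.omegaPP Ω Z″ Z h j` PULLED BACK TO THE COVER is p29 g14's `B15Eq112Admissible.omegaPP` of the pull-backs
with the constructed completion of (1.10) — for EVERY `j`.  Hypotheses: the M-cubes of the top scale and the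
`L^{−(k−j)}MR_j`-cubes, `j ≤ k₀`, have sides dividing the torus period (print's standing arrangement), `1 ≤ L, M, R_j`.
[cite: Balaban1989LargeFieldI, (1.10)–(1.12) p.179; Balaban1987RG1, (0.1) p.251] -/
theorem preimage_omegaPP_record (hL : 1 ≤ L) (hM : 1 ≤ M) (hR : ∀ j, 1 ≤ R j) (hdk : side L M k ∣ P.sitesPerDir 0)
    (hdj : ∀ j, j ≤ k₀ → side L M j * R j ∣ P.sitesPerDir 0) (j : ℕ) :
    cover P ⁻¹' B15DeterminingSets.omegaPP ΩT (ZppT L M k₀ k R ΩT ZT) ZT h j = omegaPPC L M h k₀ k R ΩT ZT j := by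
  rcases Nat.lt_or_ge h j with hj | hj
  · rw [preimage_omegaPP_of_lt _ _ _ _ _ hj, preimage_ZppT (h := h) hL hM hR hdk hdj hj, omegaPP_inter_right,
      omegaPPC_of_lt hj]
  · rw [preimage_omegaPP_of_le _ _ _ _ _ hj, omegaPPC_of_le hj]

/-- The same as an equality of sequences. [cite: Balaban1989LargeFieldI, (1.12) p.179] -/
theorem pullSeq_omegaPP_record (hL : 1 ≤ L) (hM : 1 ≤ M) (hR : ∀ j, 1 ≤ R j) (hdk : side L M k ∣ P.sitesPerDir 0)
    (hdj : ∀ j, j ≤ k₀ → side L M j * R j ∣ P.sitesPerDir 0) :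
    pullSeq (B15DeterminingSets.omegaPP ΩT (ZppT L M k₀ k R ΩT ZT) ZT h) = omegaPPC L M h k₀ k R ΩT ZT :=
  funext fun j => preimage_omegaPP_record hL hM hR hdk hdj j

/-- `1 ≤ L` under the located hypotheses. [folklore] -/
private theorem hL1 (H : Hypotheses L M h k₀ k R (pullSeq ΩT) (cover P ⁻¹' ZT)) : 1 ≤ L := le_trans (by norm_num) H.hL

/-- **THE CLAIM OF (1.12) FOR THE DECL OF RECORD**: under p29 g14's located `Hypotheses` on the cover data, r12's torus
sequence `{Ω″_j}` — instantiated with THE constructed `Z″` — read on the universal cover is a [III]-(2.13)-admissible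
sequence up to the scale `k` (unions of M-cubes of the corresponding scales, consecutive members separated by one layer).
[cite: Balaban1989LargeFieldI, (1.12) p.179; Balaban1988Convergent, (2.13) pp.256–257] -/
theorem admissible_record (H : Hypotheses L M h k₀ k R (pullSeq ΩT) (cover P ⁻¹' ZT)) (hdk : side L M k ∣ P.sitesPerDir 0)
    (hdj : ∀ j, j ≤ k₀ → side L M j * R j ∣ P.sitesPerDir 0) :
    Admissible L M k (pullSeq (B15DeterminingSets.omegaPP ΩT (ZppT L M k₀ k R ΩT ZT) ZT h)) := by
  rw [pullSeq_omegaPP_record (hL1 H) H.hM H.hR hdk hdj]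
  exact H.admissible_omegaPP_completion

/-- Under `Hypotheses`, for `h < j ≤ k` the trace is superfluous: `Z″_j` of record is the image of the constructed cover
`Z″_j` itself (print's *"a new, much smaller large field region"* `Z″_j ⊂ Z`, g14 `zpp_subset_Z`).
[cite: Balaban1989LargeFieldI, (1.11) p.179] -/
theorem zppT_eq_image (H : Hypotheses L M h k₀ k R (pullSeq ΩT) (cover P ⁻¹' ZT)) {j : ℕ} (hjk : j ≤ k) :
    ZppT L M k₀ k R ΩT ZT j = cover P '' ZppC L M k₀ k R ΩT ZT j := by
  have hsub : ZppC L M k₀ k R ΩT ZT j ⊆ cover P ⁻¹' ZT :=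
    H.zpp_subset_Z _ (isCompletion_completion H.hL H.hM H.hk (H.hR k) H.classZ
      (H.Ω_antitone (by have := H.hk; omega) le_rfl)) hjk
  rw [ZppT, Set.inter_eq_left.mpr hsub]

/-- **`Ω_j ⊆ Ω″_j` ON THE TORUS** (`j ≤ k`): the new domains of record enlarge the old ones (g14 `Ω_subset_omegaPP` carried
through the cover). [cite: Balaban1989LargeFieldI, (1.12) p.179] -/
theorem Ω_subset_omegaPP_record (H : Hypotheses L M h k₀ k R (pullSeq ΩT) (cover P ⁻¹' ZT))
    (hdk : side L M k ∣ P.sitesPerDir 0) (hdj : ∀ j, j ≤ k₀ → side L M j * R j ∣ P.sitesPerDir 0) {j : ℕ} (hjk : j ≤ k) :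
    ΩT j ⊆ B15DeterminingSets.omegaPP ΩT (ZppT L M k₀ k R ΩT ZT) ZT h j := by
  intro a ha
  obtain ⟨x, rfl⟩ := cover_surjective a
  have hx : x ∈ omegaPPC L M h k₀ k R ΩT ZT j :=
    H.Ω_subset_omegaPP _ (isCompletion_completion H.hL H.hM H.hk (H.hR k) H.classZ
      (H.Ω_antitone (by have := H.hk; omega) le_rfl)) hjk ha
  rw [← preimage_omegaPP_record (hL1 H) H.hM H.hR hdk hdj j] at hx
  exact hx

/-- **r12's (1.17) hypothesis `hdisj` DISCHARGED for the data of record**: `Z″_j ∩ Ω_j = ∅` on the torus for `h < j ≤ k`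
(g14 `zpp_disjoint_Ω` through the cover). [cite: Balaban1989LargeFieldI, (1.10)–(1.11) p.179, (1.17) p.180] -/
theorem zppT_disjoint (H : Hypotheses L M h k₀ k R (pullSeq ΩT) (cover P ⁻¹' ZT)) {j : ℕ} (hjk : j ≤ k) :
    Disjoint (ZppT L M k₀ k R ΩT ZT j) (ΩT j) := by
  rw [Set.disjoint_left]
  rintro a ⟨x, ⟨hx, -⟩, rfl⟩ ha
  have hd := H.zpp_disjoint_Ω _ (isCompletion_completion H.hL H.hM H.hk (H.hR k) H.classZ
    (H.Ω_antitone (by have := H.hk; omega) le_rfl)) hjk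
  exact Set.disjoint_left.mp hd hx ha

/-- Above the top scale the constructed completion, hence `Z″_j`, is constant (`j ≥ k`; the construction lives up to `k`).
[cite: Balaban1989LargeFieldI, (1.10) p.179] -/
theorem zppC_of_ge (hk : k₀ + 2 ≤ k) {j : ℕ} (hj : k ≤ j) : ZppC L M k₀ k R ΩT ZT j = ZppC L M k₀ k R ΩT ZT k := by
  have h1 : ¬ j ≤ k₀ := by omega
  have h2 : ¬ k ≤ k₀ := by omega
  have h3 : ¬ j ≤ k₀ + 1 := by omega
  have h4 : ¬ k ≤ k₀ + 1 := by omega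
  simp only [ZppC, Zpp, h1, h2, if_false, completion, h3, h4, Nat.sub_eq_zero_of_le hj, Nat.sub_self, widen]

/-- **r12's Part-G hypothesis `hZ` DISCHARGED for the data of record**: `Z″_j ⊆ Z″_{j+1}` on the torus for every `j > h`
(g14 `zpp_mono` below `k`, constancy above). [cite: Balaban1989LargeFieldI, (1.10)–(1.11) p.179] -/
theorem zppT_mono (H : Hypotheses L M h k₀ k R (pullSeq ΩT) (cover P ⁻¹' ZT)) {j : ℕ} (hj : h < j) :
    ZppT L M k₀ k R ΩT ZT j ⊆ ZppT L M k₀ k R ΩT ZT (j + 1) := by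
  rcases Nat.lt_or_ge j k with hjk | hjk
  · refine Set.image_mono (Set.inter_subset_inter_left _ ?_)
    exact H.zpp_mono _ (isCompletion_completion H.hL H.hM H.hk (H.hR k) H.classZ
      (H.Ω_antitone (by have := H.hk; omega) le_rfl)) hj hjk
  · intro a ha
    rw [ZppT, zppC_of_ge H.hk hjk] at ha
    rw [ZppT, zppC_of_ge H.hk (Nat.le_succ_of_le hjk)]
    exact ha

/-- **r12's Part-G hypothesis `hjoin` DISCHARGED for the data of record**: `Z ∖ Z″_{h+1} ⊆ Ω_h` on the torus (g14
`Z_diff_zpp_subset` through the cover). [cite: Balaban1989LargeFieldI, (1.11)–(1.12) p.179] -/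
theorem Z_diff_zppT_subset (H : Hypotheses L M h k₀ k R (pullSeq ΩT) (cover P ⁻¹' ZT)) :
    ZT \ ZppT L M k₀ k R ΩT ZT (h + 1) ⊆ ΩT h := by
  rintro a ⟨haZ, haZ'⟩
  obtain ⟨x, rfl⟩ := cover_surjective a
  have hx : x ∉ ZppC L M k₀ k R ΩT ZT (h + 1) := fun hx => haZ' ⟨x, ⟨hx, haZ⟩, rfl⟩
  exact H.Z_diff_zpp_subset _ ⟨haZ, hx⟩

/-- **r12's Part G `omegaPP_antitone` FOR THE DATA OF RECORD, with only print's input left**: if the old torus domains are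
nested (`Ω_{j+1} ⊆ Ω_j` for all `j` — [III] (2.1)), the torus sequence `{Ω″_j}` of record is nested; the other two hypotheses
of r12's theorem are theorems here. [cite: Balaban1989LargeFieldI, (1.12) p.179; Balaban1988Convergent, (2.1) p.254] -/
theorem antitone_record (H : Hypotheses L M h k₀ k R (pullSeq ΩT) (cover P ⁻¹' ZT)) (hΩT : ∀ j, ΩT (j + 1) ⊆ ΩT j) :
    Antitone (B15DeterminingSets.omegaPP ΩT (ZppT L M k₀ k R ΩT ZT) ZT h) :=
  B15DeterminingSets.omegaPP_antitone hΩT (fun _ hj => zppT_mono H hj) (Z_diff_zppT_subset H)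

/-- **r12's (1.17) `detSetN_top` FOR THE DATA OF RECORD, with only print's inputs left** (`{Ω_j}` nested, `1 ≤ h`): the
(1.14)–(1.16) chain of determining sets built on the torus domains of record ends in `𝔹″_k` — its disjointness hypothesis is
a theorem here. [cite: Balaban1989LargeFieldI, (1.17) p.180, (1.12) p.179] -/
theorem eq117_record (H : Hypotheses L M h k₀ k R (pullSeq ΩT) (cover P ⁻¹' ZT))
    (hΩT : ∀ ⦃a b : ℕ⦄, a ≤ b → ΩT b ⊆ ΩT a) (hh : 0 < h) :
    B15DeterminingSets.detSetN ΩT (ZppT L M k₀ k R ΩT ZT) ZT h k (k - h) =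
      B15DeterminingSets.genSetPP ΩT (ZppT L M k₀ k R ΩT ZT) ZT h k :=
  B15DeterminingSets.detSetN_top hΩT hh (by have := H.hhk; have := H.hk; omega) fun _ _ hjk => zppT_disjoint H hjk

/-- **The torus periodicity datum of p29 g12/g13 for the (1.12) sequence of record** (periods `per P`; bond cubes of side
`M₁Lⁿ`, `M₁ ∣ M`): the new large-field layers `(Ω″_n)ᶜ` read on the cover form a periodic nested cube family — the input of
the torus-contour geometry `torGeo` / of `B16Ineq147LatticeContours.ineq147_of_ineq190_torC`; [B6] Lemma 2.1 on `T_η` for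
it is g14's `Hypotheses.lemma21_full_torGeo_omegaPP` with `P := per P` (hypotheses `preimage_deck`, `per_pos`), by name.
[cite: Balaban1989LargeFieldI, (1.12) p.179, (1.47) p.186; Balaban1984PropagatorsII, (2.1)–(2.4) p.224] -/
theorem isPeriodic_record (H : Hypotheses L M h k₀ k R (pullSeq ΩT) (cover P ⁻¹' ZT)) (hdk : side L M k ∣ P.sitesPerDir 0)
    (hdj : ∀ j, j ≤ k₀ → side L M j * R j ∣ P.sitesPerDir 0) {M₁ : ℕ} (hM₁ : 0 < M₁) (hdvd : M₁ ∣ M) :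
    IsPeriodic M₁ L
      (fun n => (Admissible.extend k (pullSeq (B15DeterminingSets.omegaPP ΩT (ZppT L M k₀ k R ΩT ZT) ZT h)) n)ᶜ)
      (per P) := by
  rw [pullSeq_omegaPP_record (hL1 H) H.hM H.hR hdk hdj]
  exact H.isPeriodic_omegaPP (fun j => preimage_deck (ΩT j)) (preimage_deck ZT) per_pos (fun _ => hdk)
    (fun j hj _ => hdj j hj) hM₁ hdvd

end Bridge

/-! ## §5. Non-vacuity with a genuine `Setup.Params`: `d = 1`, `L = 3`, `m = 1`, `K = 3` (162 sites) -/

section Instance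

/-- The parameters of the instance: `d = 1`, `L = 3` (odd, as `Setup` requires), `m = 1`, `K = 3`. [folklore] -/
private abbrev Pi3 : Params :=
  { d := 1, L := 3, m := 1, K := 3, hd := le_rfl, hL := ⟨⟨1, rfl⟩, by norm_num⟩ }

/-- The finest torus of the instance has `2·3⁴ = 162` sites per direction. [folklore] -/
private theorem sites_Pi3 : Pi3.sitesPerDir 0 = 162 := by decide

/-- `R₂ = 3` (so that `L²MR₂ = L³M`), all other `R_j = 1`. [folklore] -/
private def R3 (j : ℕ) : ℕ := if j = 2 then 3 else 1

/-- The residue of the (only) coordinate of a torus site, as an integer in `[0, 162)`. [folklore] -/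
private def res (a : Site Pi3 0) : ℤ := ((a 0).val : ℤ)

/-- The torus component `Z = {0 ≤ x < 81} ⊂ ℤ/162` of the instance (`h = 0`, `k₀ = 1`, `k = 3`). [folklore] -/
private def ZT3 : Set (Site Pi3 0) := {a | res a < 81}

/-- The old torus domains of the instance: `Ω₀ = Ω₁ = T`, `Ω₂ = {x < 27} ∪ {54 ≤ x}`, `Ω₃ = {81 ≤ x} = Zᶜ` (and `Ω_j = Ω₃`
above). [folklore] -/
private def ΩT3 (j : ℕ) : Set (Site Pi3 0) :=
  if j ≤ 1 then Set.univ else if j = 2 then {a | res a < 27 ∨ 54 ≤ res a} else {a | 81 ≤ res a}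

/-- The pull-back of `Z` is `{x mod 162 < 81} ⊂ ℤ`. [folklore] -/
private theorem preimage_ZT3 : cover Pi3 ⁻¹' ZT3 = {x : Pt 1 | x 0 % 162 < 81} := by
  ext x
  simp only [Set.mem_preimage, ZT3, res, Set.mem_setOf_eq, val_cover, sites_Pi3, Nat.cast_ofNat]

/-- The pull-backs of the `Ω_j`. [folklore] -/
private theorem pullSeq_ΩT3 : pullSeq ΩT3 = fun j =>
    if j ≤ 1 then Set.univ else if j = 2 then {x : Pt 1 | x 0 % 162 < 27 ∨ 54 ≤ x 0 % 162}
      else {x : Pt 1 | 81 ≤ x 0 % 162} := by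
  funext j
  ext x
  simp only [pullSeq, Set.mem_preimage, ΩT3, res]
  split_ifs <;> simp only [Set.mem_univ, Set.mem_setOf_eq, val_cover, sites_Pi3, Nat.cast_ofNat]

/-- In `ℤ¹` the cube index is the floor quotient of the only coordinate. [folklore] -/
private theorem cubeIdx_eq_iff (s : ℕ) (x y : Pt 1) : cubeIdx s x = cubeIdx s y ↔ x 0 / (s : ℤ) = y 0 / (s : ℤ) := by
  constructor
  · intro h; exact congrFun h 0
  · intro h; funext i; fin_cases i; exact h

/-- **Non-vacuity**: p29 g14's `Hypotheses 3 1 0 1 3 R` hold for the pull-backs of the torus data above, `Z ≠ ∅`, `Ω₀ = T`,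
`{Ω_j}` is nested, and the cube sides divide the period: `L³M = 27 ∣ 162`, `LʲMR_j ∣ 162` (`j ≤ 1`).
[cite: Balaban1989LargeFieldI, (1.10)–(1.12) p.179; Balaban1987RG1, (0.1) p.251] -/
private theorem hypotheses_Pi3 :
    Hypotheses 3 1 0 1 3 R3 (pullSeq ΩT3) (cover Pi3 ⁻¹' ZT3) ∧ ZT3.Nonempty ∧ (∀ j, ΩT3 (j + 1) ⊆ ΩT3 j) ∧
      side 3 1 3 ∣ Pi3.sitesPerDir 0 ∧ (∀ j, j ≤ 1 → side 3 1 j * R3 j ∣ Pi3.sitesPerDir 0) := by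
  refine ⟨?_, ?_, ?_, by rw [sites_Pi3]; norm_num [side], ?_⟩
  · rw [pullSeq_ΩT3, preimage_ZT3]
    refine ⟨by norm_num, le_rfl, fun j => by unfold R3; split_ifs <;> omega, by norm_num, by norm_num,
      by simp [side, R3], ⟨?_, ?_⟩, ?_, ⟨?_, ?_⟩⟩
    · -- cubes of `Ω_j`
      intro j hj x y hxy
      rw [cubeIdx_eq_iff] at hxy
      interval_cases j
      · simp
      · simp
      · simp [side] at hxy ⊢; omega
      · simp [side] at hxy ⊢; omega
    · -- separation of `Ω_j`
      intro j hj x hx y hy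
      have hy0 := abs_le.mp (hy 0)
      interval_cases j
      · simp
      · simp
      · simp [side] at hx hy0 ⊢; omega
    · -- margin: `Ω₀ = Ω₁ = T`
      intro j hj hj1 x _
      interval_cases j <;> simp
    · -- `Z` is a union of `27`-cubes
      intro x y hxy
      rw [cubeIdx_eq_iff] at hxy
      simp only [side, R3] at hxy
      norm_num at hxy
      simp only [Set.mem_setOf_eq]
      omega
    · -- closedness: `Ω₃ᶜ = Z`
      intro x y _ hx _
      have hx' : ¬ (81 ≤ x 0 % 162) := by simpa using hx
      show x 0 % 162 < 81
      omega
  · -- `Z ≠ ∅`: the origin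
    refine ⟨fun _ => 0, ?_⟩
    simp [ZT3, res]
  · -- `{Ω_j}` nested
    intro j a ha
    rcases Nat.lt_or_ge j 3 with hj | hj
    · interval_cases j
      · simp [ΩT3]
      · simp [ΩT3]
      · simp [ΩT3] at ha ⊢; omega
    · have h1 : ¬ j + 1 ≤ 1 := by omega
      have h2 : ¬ j + 1 = 2 := by omega
      have h3 : ¬ j ≤ 1 := by omega
      have h4 : ¬ j = 2 := by omega
      simp only [ΩT3, h1, h2, h3, h4, if_false] at ha ⊢
      exact ha
  · -- `LʲMR_j ∣ 162` for `j ≤ 1`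
    intro j hj
    rw [sites_Pi3]
    interval_cases j <;> norm_num [side, R3]

/-- **THE BRIDGE IS NOT VACUOUS**: on the genuine `Setup` torus `ℤ/162` the torus sequence of record
`B15DeterminingSets.omegaPP Ω Z″ Z 0` of the data above pulls back to a [III]-(2.13)-admissible sequence up to the scale `3`,
is nested, enlarges `{Ω_j}`, and its `Z″_j` avoid `Ω_j` — every hypothesis of §4 met at once.
[cite: Balaban1989LargeFieldI, (1.12) p.179; Balaban1987RG1, (0.1) p.251] -/
theorem record_instance :
    Admissible 3 1 3 (pullSeq (B15DeterminingSets.omegaPP ΩT3 (ZppT 3 1 1 3 R3 ΩT3 ZT3) ZT3 0)) ∧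
      Antitone (B15DeterminingSets.omegaPP ΩT3 (ZppT 3 1 1 3 R3 ΩT3 ZT3) ZT3 0) ∧
      (∀ j, j ≤ 3 → ΩT3 j ⊆ B15DeterminingSets.omegaPP ΩT3 (ZppT 3 1 1 3 R3 ΩT3 ZT3) ZT3 0 j) ∧
      (∀ j, j ≤ 3 → Disjoint (ZppT 3 1 1 3 R3 ΩT3 ZT3 j) (ΩT3 j)) ∧ ZT3.Nonempty := by
  obtain ⟨H, hne, hnest, hdk, hdj⟩ := hypotheses_Pi3
  exact ⟨admissible_record H hdk hdj, antitone_record H hnest, fun j hj => Ω_subset_omegaPP_record H hdk hdj hj,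
    fun j hj => zppT_disjoint H hj, hne⟩

end Instance

end Literature.MathematicalPhysics.QuantumFieldTheory.Balaban1983to89.B15Eq112TorusCover
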